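import Summits.BirchSwinnertonDyer.BirchSwinnertonDyer.Theorems.SignedLowerHalvesSmallImageLowerHalfBothSignsRttD2SeqSemilocUnramGen
import Summits.BirchSwinnertonDyer.BirchSwinnertonDyer.Theorems.SignedLowerHalvesSmallImageLowerHalfBothSignsRttD2SeqSemilocOfGen
import HarnessLib

/-!
# Route `SignedLowerHalves`, crux L `SmallImageLowerHalfBothSigns` (stmt-BirchSwinnertonDyer-23599), line `rtt_w3` v32 — stub S3β″ (`stub_junctionPT_ns`, row J4′, Poitou–Tate half):
# ★★★ S3β″ CLOSED ON THE SKELETON'S Γ-BINDERS — `λ(Λ_𝒪 ⧸ (E)) ≤ λ(Y″) + λ(I.H ⧸ B′)` WITHOUT ANY EXTRA HYPOTHESIS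

WIDTH seat `bsd-line-slh-p3-w3` g27 under LEAD `cruxlead-stmt-BirchSwinnertonDyer-23599` g14 (cell `bsd-ssimc`); helper `--supports stmt-BirchSwinnertonDyer-23599`.
THEOREMS ONLY (no definition, no named fact, no instance, no `sorry`). HONEST FRAMING: assembly. §1 discharges the unramified-generator hypothesis `hgen` of g27's
`lambdaInvariant_quotient_junctionDepletion_le_of_generators` (p819278) from the stub's own binders: for `w ∈ T` (`w ∉ supp(p𝔣)`), the Frobenius `φ_w` (hφ) lifts to `Γ_{K_w}` (C2), the
exponent clause (hx) is the one of `exists_unramified_generator` (g27 `…RttD2SeqSemilocUnramGen`) for the orientation `γK⁻¹` (`κ(γK⁻¹) = −1`, a unit), `θ′|_{N_P} = 1` by (U), `N_P` fixes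
`μ_{p^∞}` because every place above `p` is `vp ∈ supp(p𝔣)`. §2 is the REGISTERED conclusion of `stub_junctionPT_ns` (`JunctionDepletion`, `JunctionLamY2`, `JunctionCarrier` unfolded) from the
stub's Γ-binders alone. S3β″ is a λ-INEQUALITY between Iwasawa invariants of modules attached to the frame; crux L (`SmallImageLowerHalfBothSigns`), crux M, S3α″, S4″ and BSD remain OPEN
and are proved for NO curve by this file.
References: [Rubin2000] Thm. 1.7.3, §4.2, App. B.3; [Kobayashi2003] Thm. 7.3 i); [PerrinRiou1994Invent] §1.3; [GreenbergVatsal2000] §2 Prop. (2.4); [Washington1997] §13.2;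
[SerreLocalFields1979] XIII §1; [NeukirchSchmidtWingberg2008] (7.2.6), (8.6.2)–(8.6.3).
-/

set_option autoImplicit false
set_option linter.dupNamespace false -- D-0017: single-problem summit, the namespace repeats the problem name by design
noncomputable section

open scoped Classical
open NumberField IsDedekindDomain Field Matrix CategoryTheory Function Rat.HeightOneSpectrum

namespace Summit.BirchSwinnertonDyer.BirchSwinnertonDyer.Theorems.SmallImageRttD2Seq

open Literature.NumberTheory.EllipticCurves Literature.NumberTheory.EllipticCurves.GreenbergSelmer Literature.NumberTheory.GaloisRepresentations
  Literature.NumberTheory.GaloisRepresentations.DiscreteGaloisModule Literature.NumberTheory.GaloisCohomology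
  Literature.NumberTheory.EllipticCurves.GreenbergVatsal2000 Literature.NumberTheory.ComplexMultiplication.EllipticUnits.JohnsonLeungKings2011
  Summit.BirchSwinnertonDyer.BirchSwinnertonDyer.Theorems.SmallImageCharSignedSelmer Summit.BirchSwinnertonDyer.BirchSwinnertonDyer.Theorems.SmallImageRttD2J1
  IsDedekindDomain.HeightOneSpectrum

/-! ## §1. The unramified generators on the skeleton's Γ-binders -/

set_option maxHeartbeats 800000 in
/-- ★★ **THE UNRAMIFIED GENERATORS `u_w`, `w ∈ T`, ON THE SKELETON'S Γ-BINDERS** — exactly the hypothesis `hgen` of `lambdaInvariant_quotient_junctionDepletion_le_of_generators` (p819278):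
for the restricted cyclotomic tower of the quadratic `K` (orientation `γK⁻¹`), the place `vp = (p)`, a frame character `θ′` with (U), and `T ⊆ S₀K ∖ supp(p𝔣)` with arithmetic Frobenius
elements `φ_w` and exponents `x_w` (`γK⁻¹^{x_w mod pⁿ} φ_w⁻¹ ∈ U_n`): every `w ∈ T` carries `u_w ∈ 𝐇¹_{Iw,w}` unramified at all levels with `Ann_{Λ_𝒪}(u_w) = ((1+T)^{x_w} − C(θ′(φ_w)χ_cyc(φ_w)))`.
[cite: SerreLocalFields1979, XIII §1 Prop. 1] [cite: PerrinRiou1994Invent, §1.3] [cite: Rubin2000, App. B.3] [cite: Washington1997, §13.2] -/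
theorem exists_unramified_generators_of_frame
    {p : ℕ} [Fact p.Prime] (hp : p ≠ 2) {κ : ZpExtension ℚ p} {K : Type} [Field K] [NumberField K] (hK2 : Module.finrank ℚ K = 2)
    (S : Set (PadicAlgCl p)) (hS : 0 < Module.finrank ℚ_[p] (padicCoeffField S)) {γK : absoluteGaloisGroup K} (hγK : (κ.restrictOfFinrankEqTwo hp K hK2).IsTopGenerator γK)
    (S₀ : Finset (HeightOneSpectrum (𝓞 ℚ))) (vp : HeightOneSpectrum (𝓞 K)) (hv : vp.asIdeal = Ideal.span {((p : ℕ) : 𝓞 K)})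
    {θ' : absoluteGaloisGroup K →ₜ* (padicCoeffIntegers S)ˣ} {𝔣 : Ideal (𝓞 K)}
    (hU : ∀ w : HeightOneSpectrum (𝓞 K), w ∉ suppPF p 𝔣 → ∀ 𝔓 ∈ w.primesAbove, ∀ τ ∈ 𝔓.inertia (absoluteGaloisGroup K), θ' τ = 1)
    (T : Finset (HeightOneSpectrum (𝓞 K))) (φ : HeightOneSpectrum (𝓞 K) → absoluteGaloisGroup K) (x : HeightOneSpectrum (𝓞 K) → ℤ_[p])
    (hT : ∀ w, w ∈ T ↔ (w ∈ {w : HeightOneSpectrum (𝓞 K) | ∃ v ∈ S₀, ((natGenerator v : ℕ) : 𝓞 K) ∈ w.asIdeal} ∧ w ∉ suppPF p 𝔣))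
    (hφ : ∀ w ∈ T, IsArithFrobAt (𝓞 K) (φ w) (adicCompletionPrime K w))
    (hx : ∀ w ∈ T, ∀ n : ℕ, γK⁻¹ ^ (PadicInt.toZModPow n (x w)).val * (φ w)⁻¹ ∈ (κ.restrictOfFinrankEqTwo hp K hK2).layerSubgroup n) :
    haveI : FiniteDimensional ℚ_[p] (padicCoeffField S) := Module.finite_of_finrank_pos hS
      ∀ w ∈ T, ∃ u : (semilocIwasawaCohomologyDataO S (κ.restrictOfFinrankEqTwo hp K hK2) γK⁻¹ θ' (suppPF p 𝔣) w 1).H,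
        (∀ f : IwasawaAlgebraO S, f • u = 0 ↔ f ∈ Ideal.span {iwasawaToIwasawaO S (PowerSeries.binomialSeries ℤ_[p] (x w)) -
          PowerSeries.C (((θ' (φ w) : (padicCoeffIntegers S)ˣ) : padicCoeffIntegers S) *
            padicIntToCoeffIntegers S ((GaloisRep.cyclotomicCharacter K p (φ w) : ℤ_[p]ˣ) : ℤ_[p]))}) ∧
        ∀ n k : ℕ, (semilocIwasawaCohomologyDataO S (κ.restrictOfFinrankEqTwo hp K hK2) γK⁻¹ θ' (suppPF p 𝔣) w 1).proj n k u ∈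
          unramifiedLevelΛ S (κ.restrictOfFinrankEqTwo hp K hK2) γK⁻¹ θ' (suppPF p 𝔣) w n k := by
  haveI : FiniteDimensional ℚ_[p] (padicCoeffField S) := Module.finite_of_finrank_pos hS
  intro w hw
  have hwP : w ∉ suppPF p 𝔣 := ((hT w).1 hw).2
  have hNP : ∀ n, ramificationSubgroup K (suppPF p 𝔣) ≤ (κ.restrictOfFinrankEqTwo hp K hK2).layerSubgroup n :=
    ramificationSubgroup_suppPF_le_layerSubgroup (κ.restrictOfFinrankEqTwo hp K hK2) 𝔣
  have hγ : ((κ.restrictOfFinrankEqTwo hp K hK2) γK⁻¹).toAdd = ((-1 : ℤ_[p]ˣ) : ℤ_[p]) := by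
    rw [map_inv, toAdd_inv, Units.val_neg, Units.val_one]
    exact congrArg (fun t ↦ -Multiplicative.toAdd t) hγK
  have hθN : ∀ g ∈ ramificationSubgroup K (suppPF p 𝔣), θ' g = 1 := frame_eq_one_of_mem_ramificationSubgroup S hU
  have hpv : ∀ w : HeightOneSpectrum (𝓞 K), ((p : ℕ) : 𝓞 K) ∈ w.asIdeal → w = vp := eq_of_natCast_mem_asIdeal_of_eq_span hv
  have hvP : vp ∈ suppPF p 𝔣 := mem_suppPF_of_eq_span 𝔣 hv
  have hPp : ∀ w : HeightOneSpectrum (𝓞 K), w ∉ suppPF p 𝔣 → ((p : ℕ) : 𝓞 K) ∉ w.asIdeal := fun w hw hpw ↦ hw (hpv w hpw ▸ hvP)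
  have hμN : ∀ k : ℕ, ∀ g ∈ ramificationSubgroup K (suppPF p 𝔣), ∀ ζ : MuCarrier K (p ^ k), mu K (p ^ k) g ζ = ζ :=
    fun k g hg ζ ↦ mu_apply_eq_self_of_mem_ramificationSubgroup (suppPF p 𝔣) hPp k hg ζ
  obtain ⟨φl, hφl, hres⟩ := exists_isFrobPow_one_resGalOfEmb_eq w (hφ w hw)
  have hx' : ∀ n : ℕ, γK⁻¹ ^ (PadicInt.toZModPow n (x w)).val * (resGalOfEmb (closureEmb (K := K) (w.adicCompletion K)) φl)⁻¹ ∈ (κ.restrictOfFinrankEqTwo hp K hK2).layerSubgroup n := by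
    rw [hres]; exact hx w hw
  have h := exists_unramified_generator S (κ.restrictOfFinrankEqTwo hp K hK2) γK⁻¹ θ' (suppPF p 𝔣) w hwP hNP hγ hθN hμN hφl hx'
  rw [hres] at h
  exact h

/-! ## §2. S3β″ on the Γ-binders, unconditionally -/

set_option maxHeartbeats 1600000 in
/-- ★★★ **S3β″ (`stub_junctionPT_ns`, line `rtt_w3` v32) ON THE SKELETON'S Γ-BINDERS — NO EXTRA HYPOTHESIS.** For the cyclotomic `κ` of `ℚ` (generator `γ`, cyclotomic variable) restricted to the
quadratic `K` (`p ≠ 2`, `p ∤ d_K`, `vp = (p)` inert), the frame `(θ′, 𝔣)` with `θ′·θ₀₀ = 1`, `𝔣 ≠ 0` and the support conditions (R)/(U), the curve/character clauses `hθ` (unramified off `p𝔪`),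
`hbad`, `hS₀bad`, `hS₀p`, the dual datum `Dψ` (finitely generated torsion), honda's cyclotomic model `I` and `T ⊆ S₀K ∖ supp(p𝔣)` with arithmetic Frobenius data `(φ, x, d)`:
`λ(Λ_𝒪 ⧸ (C(p^d)·∏_{w∈T} P_w)) ≤ λ(Y″) + λ(I.H ⧸ range B′.subtype)` — the registered conclusion with `JunctionDepletion`, `JunctionLamY2`, `JunctionCarrier` unfolded. (= p819278 with `hgen` discharged by §1.)
[cite: Rubin2000, Thm. 1.7.3, §4.2, App. B.3] [cite: Kobayashi2003, Thm. 7.3 i)] [cite: PerrinRiou1994Invent, §1.3] [cite: GreenbergVatsal2000, §2 Prop. (2.4)] [cite: Washington1997, §13.2] -/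
theorem lambdaInvariant_quotient_junctionDepletion_le
    {p : ℕ} [Fact p.Prime] (hp : p ≠ 2) {κ : ZpExtension ℚ p} (hκ : κ.IsCyclotomic) {γ : absoluteGaloisGroup ℚ} (hγ : κ.IsTopGenerator γ) (hcv : IsCyclotomicVariable p γ)
    {K : Type} [Field K] [NumberField K] (hK2 : Module.finrank ℚ K = 2) (hnd : ¬ (p : ℤ) ∣ NumberField.discr K)
    (S : Set (PadicAlgCl p)) (hS : 0 < Module.finrank ℚ_[p] (padicCoeffField S)) (θ : FramedGaloisRep K (padicCoeffIntegers S) 1) (W : WeierstrassCurve ℚ)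
    (j : (W.baseChange K).geomPrimaryTorsion p →+ Cofree θ (padicCoeffField S)) (ε : ℤˣ)
    {γK : absoluteGaloisGroup K} (hγK : (κ.restrictOfFinrankEqTwo hp K hK2).IsTopGenerator γK)
    (S₀ : Finset (HeightOneSpectrum (𝓞 ℚ))) (hS₀p : ∀ v ∈ S₀, ((p : ℕ) : 𝓞 ℚ) ∉ v.asIdeal)
    (hS₀bad : ∀ v : HeightOneSpectrum (𝓞 ℚ), ¬ W.HasGoodReductionAt v → v ∈ S₀) {𝔪 : Ideal (𝓞 K)}
    (hbad : ∀ (ℓ : ℕ) [Fact ℓ.Prime], ℓ ∣ (NumberField.discr K).natAbs * Ideal.absNorm 𝔪 → ¬ W.HasGoodReductionAtPrime ℓ)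
    (hθunr : ∀ w : HeightOneSpectrum (𝓞 K), (p : 𝓞 K) ∉ w.asIdeal → ¬ 𝔪 ≤ w.asIdeal → FramedGaloisRep.IsUnramifiedAt w θ)
    (D : SignedTransportDualDataSat (κ.restrictOfFinrankEqTwo hp K hK2) γK (Cofree θ (padicCoeffField S)) (padicCoeffIntegers S) (W.baseChange K) j
      {w : HeightOneSpectrum (𝓞 K) | ∃ v ∈ S₀, ((natGenerator v : ℕ) : 𝓞 K) ∈ w.asIdeal} ε)
    (hDfin : Module.Finite (IwasawaAlgebra p) D.X) (hDtor : Module.IsTorsion (IwasawaAlgebra p) D.X)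
    (vp : HeightOneSpectrum (𝓞 K)) (hv : vp.asIdeal = Ideal.span {((p : ℕ) : 𝓞 K)})
    {θ' : absoluteGaloisGroup K →ₜ* (padicCoeffIntegers S)ˣ} {𝔣 : Ideal (𝓞 K)} (h𝔣 : 𝔣 ≠ ⊥)
    (hθ'θ : ∀ g : absoluteGaloisGroup K, ((θ' g : (padicCoeffIntegers S)ˣ) : padicCoeffIntegers S) *
      ((θ g : GL (Fin 1) (padicCoeffIntegers S)) : Matrix (Fin 1) (Fin 1) (padicCoeffIntegers S)) 0 0 = 1)
    (hR : ∀ w ∈ suppPF p 𝔣, ((p : ℕ) : 𝓞 K) ∉ w.asIdeal → ∃ 𝔓 ∈ w.primesAbove, ∃ τ ∈ 𝔓.inertia (absoluteGaloisGroup K), θ' τ ≠ 1)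
    (hU : ∀ w : HeightOneSpectrum (𝓞 K), w ∉ suppPF p 𝔣 → ∀ 𝔓 ∈ w.primesAbove, ∀ τ ∈ 𝔓.inertia (absoluteGaloisGroup K), θ' τ = 1)
    (I : CycIwasawaCohomologyDataO S (κ.restrictOfFinrankEqTwo hp K hK2) γK⁻¹ θ' (suppPF p 𝔣) 1)
    (T : Finset (HeightOneSpectrum (𝓞 K))) (φ : HeightOneSpectrum (𝓞 K) → absoluteGaloisGroup K) (x : HeightOneSpectrum (𝓞 K) → ℤ_[p]) (d : ℕ)
    (hT : ∀ w, w ∈ T ↔ (w ∈ {w : HeightOneSpectrum (𝓞 K) | ∃ v ∈ S₀, ((natGenerator v : ℕ) : 𝓞 K) ∈ w.asIdeal} ∧ w ∉ suppPF p 𝔣))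
    (hφ : ∀ w ∈ T, IsArithFrobAt (𝓞 K) (φ w) (adicCompletionPrime K w))
    (hx : ∀ w ∈ T, ∀ n : ℕ, γK⁻¹ ^ (PadicInt.toZModPow n (x w)).val * (φ w)⁻¹ ∈ (κ.restrictOfFinrankEqTwo hp K hK2).layerSubgroup n) :
    haveI : FiniteDimensional ℚ_[p] (padicCoeffField S) := Module.finite_of_finrank_pos hS
    letI : Algebra (IwasawaAlgebra p) (IwasawaAlgebraO S) := (iwasawaToIwasawaO S).toAlgebra
    letI := I.moduleIwasawa
    haveI := I.isScalarTower_moduleIwasawa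
    lambdaInvariant p (IwasawaAlgebraO S ⧸ Ideal.span {PowerSeries.C ((p : padicCoeffIntegers S) ^ d) *
        ∏ w ∈ T, (iwasawaToIwasawaO S (PowerSeries.binomialSeries ℤ_[p] (x w)) -
          PowerSeries.C (((θ' (φ w) : (padicCoeffIntegers S)ˣ) : padicCoeffIntegers S) *
            padicIntToCoeffIntegers S ((GaloisRep.cyclotomicCharacter K p (φ w) : ℤ_[p]ˣ) : ℤ_[p])))}) ≤
      (letI := localAction (closureEmb (K := K) (vp.adicCompletion K)) (Cofree θ (padicCoeffField S))
       @lambdaInvariant p _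
        (locImageQuot (κ.restrictOfFinrankEqTwo hp K hK2) (Cofree θ (padicCoeffField S)) (padicCoeffIntegers S) (W.baseChange K) j
            {w : HeightOneSpectrum (𝓞 K) | ∃ v ∈ S₀, ((natGenerator v : ℕ) : 𝓞 K) ∈ w.asIdeal} ε vp (fun _ _ ↦ rfl) (natCast_mem_asIdeal_of_eq_span hv)
            ({w : HeightOneSpectrum (𝓞 K) | ∃ v ∈ S₀, ((natGenerator v : ℕ) : 𝓞 K) ∈ w.asIdeal} ∪ {w : HeightOneSpectrum (𝓞 K) | ((p : ℕ) : 𝓞 K) ∈ w.asIdeal}) →+ AddCircle (1 : ℚ)) _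
        (locImageDualModule (κ.restrictOfFinrankEqTwo hp K hK2) (padicCoeffIntegers S) (W.baseChange K) j
          {w : HeightOneSpectrum (𝓞 K) | ∃ v ∈ S₀, ((natGenerator v : ℕ) : 𝓞 K) ∈ w.asIdeal} ε vp (fun _ _ ↦ rfl) (natCast_mem_asIdeal_of_eq_span hv)
          ({w : HeightOneSpectrum (𝓞 K) | ∃ v ∈ S₀, ((natGenerator v : ℕ) : 𝓞 K) ∈ w.asIdeal} ∪ {w : HeightOneSpectrum (𝓞 K) | ((p : ℕ) : 𝓞 K) ∈ w.asIdeal})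
          (isNonsplitIn_restrictOfFinrankEqTwo hp hκ K hK2 hnd (natCast_mem_asIdeal_of_eq_span hv))
          (GreenbergSelmer.exists_pow_smul_cofree_eq_zero S θ) (GreenbergSelmer.isOpen_stabilizer_cofree S θ) hγK)) +
        lambdaInvariant p (I.H ⧸ LinearMap.range (Submodule.subtype
          (strictCarrier I (strictLevel S (κ.restrictOfFinrankEqTwo hp K hK2) θ' (suppPF p 𝔣) {w : HeightOneSpectrum (𝓞 K) | ∃ v ∈ S₀, ((natGenerator v : ℕ) : 𝓞 K) ∈ w.asIdeal})
            (fun n k f _ hy ↦ smul_mem_strictLevel S (κ.restrictOfFinrankEqTwo hp K hK2) θ' (suppPF p 𝔣)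
              {w : HeightOneSpectrum (𝓞 K) | ∃ v ∈ S₀, ((natGenerator v : ℕ) : 𝓞 K) ∈ w.asIdeal} γK⁻¹ n k f hy)))) :=
  lambdaInvariant_quotient_junctionDepletion_le_of_generators hp hκ hγ hcv hK2 hnd S hS θ W j ε hγK S₀ hS₀p hS₀bad hbad hθunr D hDfin hDtor vp hv h𝔣 hθ'θ hR hU I T φ x d hT
    (exists_unramified_generators_of_frame hp hK2 S hS hγK S₀ vp hv hU T φ x hT hφ hx)

end Summit.BirchSwinnertonDyer.BirchSwinnertonDyer.Theorems.SmallImageRttD2Seq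

end
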